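import Literature.NumberTheory.LFunctions.RayClassXi
import Literature.NumberTheory.LFunctions.SymmetricHadamardExpansion
import HarnessLib

/-!
# The symmetric pair `Ξ(s) = ξ(s, χ) ξ(s, χ̄)` of a completed Hecke `L`-function with conductor

Topic `Literature/NumberTheory/LFunctions` (namespace `Literature.NumberTheory.LFunctions`), continuing
`RayClassXi.lean` (`RayXiData`: `ξ(1 − s) = W ξ̃(s)` for the swapped data); the ray-class counterpart of the tree's
`ClassGroupXiPair.lean`.  Everything here is PROVED (one definition with body, `RayXiData.xiPair`, and theorems).

For analytic data `T = (L, L', W)` of conductor `𝔣` and sign type `p`, the PAIR `Ξ_T(s) = ξ_T(s) ξ_{T̃}(s)`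
(`T̃ = (L', L, W⁻¹)`) is entire, SYMMETRIC (`Ξ(1 − s) = Ξ(s)`, as `W · W⁻¹ = 1`), of growth `exp(‖s‖^{31/16})`, with
all zeros in `Re s ≤ 1`, so the tree's symmetric Hadamard expansion applies (`nonempty_symmHadamardData_xiPair`).
`Ξ` has an (at least) double zero at `s = 1` (both `ξ`'s carry the factor `s − 1`), and a common zero of `L` and
`L'` in `Re s > 0` is a multiple zero of `Ξ` (used for a real zero of a real character: `L'(β) = conj L(β)`).  On
`Re s > 1`:
`Ξ'/Ξ(s) = 2/s + 2/(s−1) + log A + 2 L_∞'/L_∞(s) + L'/L(s) + L''/L'(s)` (`logDeriv_xiPair`), `A = |d_K| N𝔣`.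
This is the device "`Λ(s,χ)Λ(s,χ̄)` is symmetric even when `Λ(s,χ)` is not"
[cite: LagariasMontgomeryOdlyzko1979, §3] [cite: ThornerZaman2017, §7].

## References
* J. C. Lagarias, H. L. Montgomery, A. M. Odlyzko, Invent. Math. 54 (1979), §3. [LagariasMontgomeryOdlyzko1979]
* J. Thorner, A. Zaman, Algebra Number Theory 11 (2017), §7. [ThornerZaman2017]
* H. M. Stark, Invent. Math. 23 (1974), Lemma 3. [Stark1974]
-/

noncomputable section

open scoped NumberField
open Complex Filter Topology Set Metric NumberField NumberField.InfinitePlace IsDedekindDomain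

namespace Literature.NumberTheory.LFunctions

open Literature.NumberTheory.LFunctions.NumberField Literature.NumberTheory.LFunctions.Stark1974

variable {K : Type*} [Field K] [NumberField K]
variable {𝔣 : Ideal (𝓞 K)} {p : Finset {w : InfinitePlace K // IsReal w}}

namespace RayXiData

variable (T : RayXiData K 𝔣 p)

/-! ### The symmetric pair -/

/-- **`Ξ_T(s) = ξ_T(s) ξ_{T̃}(s)`**, entire and symmetric under `s ↦ 1 − s`.
[cite: LagariasMontgomeryOdlyzko1979, §3] -/
def xiPair (s : ℂ) : ℂ := T.xi s * T.swap.xi s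

/-- `Ξ` is entire. [cite: LagariasMontgomeryOdlyzko1979, §3] -/
theorem differentiable_xiPair : Differentiable ℂ T.xiPair :=
  T.differentiable_xi.mul T.swap.differentiable_xi

/-- **`Ξ(1 − s) = Ξ(s)`** (`W · W⁻¹ = 1`). [cite: LagariasMontgomeryOdlyzko1979, §3] -/
theorem xiPair_one_sub (s : ℂ) : T.xiPair (1 - s) = T.xiPair s := by
  rw [xiPair, xiPair, T.xi_one_sub s, T.swap.xi_one_sub s, swap_swap, swap_W]
  have h := mul_inv_cancel₀ T.W_ne_zero
  linear_combination (T.swap.xi s * T.xi s) * h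

/-- Growth of the pair: `‖Ξ(s)‖ ≤ C exp(‖s‖^{31/16})`. [cite: ThornerZaman2017, §2.2] -/
theorem exists_norm_xiPair_le : ∃ C : ℝ, ∀ s : ℂ, ‖T.xiPair s‖ ≤ C * Real.exp (‖s‖ ^ (31 / 16 : ℝ)) := by
  obtain ⟨C₁, hC₁0, hC₁⟩ := T.exists_norm_xi_le
  obtain ⟨C₂, hC₂0, hC₂⟩ := T.swap.exists_norm_xi_le
  obtain ⟨A, hA0, hA⟩ := Stark1974.exists_mul_add_rpow_le (μ := 15 / 8) (μ' := 31 / 16) (c := 2)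
    (a := 0) (by norm_num) (by norm_num) (by norm_num) le_rfl
  refine ⟨C₁ * C₂ * Real.exp A, fun s ↦ ?_⟩
  rw [xiPair, norm_mul]
  have h2 : 2 * ‖s‖ ^ (15 / 8 : ℝ) ≤ ‖s‖ ^ (31 / 16 : ℝ) + A := by
    have := hA ‖s‖ (norm_nonneg s); rwa [zero_add] at this
  calc ‖T.xi s‖ * ‖T.swap.xi s‖
      ≤ (C₁ * Real.exp (‖s‖ ^ (15 / 8 : ℝ))) * (C₂ * Real.exp (‖s‖ ^ (15 / 8 : ℝ))) :=
        mul_le_mul (hC₁ s) (hC₂ s) (norm_nonneg _) (by positivity)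
    _ = C₁ * C₂ * Real.exp (2 * ‖s‖ ^ (15 / 8 : ℝ)) := by rw [two_mul, Real.exp_add]; ring
    _ ≤ C₁ * C₂ * Real.exp (‖s‖ ^ (31 / 16 : ℝ) + A) := by gcongr
    _ = C₁ * C₂ * Real.exp A * Real.exp (‖s‖ ^ (31 / 16 : ℝ)) := by rw [Real.exp_add]; ring

/-- The zeros of `Ξ` have `Re s ≤ 1`. [cite: ThornerZaman2017, §2.2] -/
theorem re_le_one_of_xiPair_eq_zero {s : ℂ} (hs : T.xiPair s = 0) : s.re ≤ 1 := by
  rcases mul_eq_zero.mp hs with h | h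
  · exact (T.re_mem_of_xi_eq_zero h).2
  · exact (T.swap.re_mem_of_xi_eq_zero h).2

/-- `Ξ(s) ≠ 0` for `Re s > 1`. [cite: ThornerZaman2017, §2.2] -/
theorem xiPair_ne_zero_of_one_lt_re {s : ℂ} (hs : 1 < s.re) : T.xiPair s ≠ 0 :=
  mul_ne_zero (T.xi_ne_zero_of_one_lt_re hs) (T.swap.xi_ne_zero_of_one_lt_re hs)

/-- **The symmetric Hadamard expansion applies to `Ξ`.** [cite: Stark1974, Lemma 3] -/
theorem nonempty_symmHadamardData_xiPair : Nonempty (SymmHadamardData T.xiPair) := by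
  obtain ⟨C, hC⟩ := T.exists_norm_xiPair_le
  exact Stark1974.exists_symmHadamardData T.differentiable_xiPair T.xiPair_one_sub
    (by norm_num : (31 / 16 : ℝ) < 2) (by norm_num) hC (fun s hs ↦ T.re_le_one_of_xiPair_eq_zero hs)

/-- If both `ξ_T(ρ) = 0` and `ξ_{T̃}(ρ) = 0` then `ρ` is a multiple zero of `Ξ`. [cite: ThornerZaman2017, §7.2] -/
theorem xiPair_eq_zero_and_deriv_eq_zero {ρ : ℂ} (h₁ : T.xi ρ = 0) (h₂ : T.swap.xi ρ = 0) :
    T.xiPair ρ = 0 ∧ deriv T.xiPair ρ = 0 := by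
  refine ⟨by rw [xiPair, h₁, zero_mul], ?_⟩
  have hd := ((T.differentiable_xi ρ).hasDerivAt.mul (T.swap.differentiable_xi ρ).hasDerivAt).deriv
  have : T.xiPair = T.xi * T.swap.xi := rfl
  rw [this, hd, h₁, h₂]; ring

/-- `s = 1` is a multiple zero of `Ξ` (both factors vanish there). [cite: ThornerZaman2017, §7.2] -/
theorem xiPair_one : T.xiPair 1 = 0 ∧ deriv T.xiPair 1 = 0 :=
  T.xiPair_eq_zero_and_deriv_eq_zero T.xi_one T.swap.xi_one

/-- A common zero `ρ` (`Re ρ > 0`) of `L` and `L'` is a multiple zero of `Ξ`. [cite: ThornerZaman2017, §7.2] -/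
theorem xiPair_double_of_L {ρ : ℂ} (hρ : 0 < ρ.re) (h₁ : T.L ρ = 0) (h₂ : T.L' ρ = 0) :
    T.xiPair ρ = 0 ∧ deriv T.xiPair ρ = 0 :=
  T.xiPair_eq_zero_and_deriv_eq_zero (T.xi_eq_zero_of_L_eq_zero hρ h₁)
    (T.swap.xi_eq_zero_of_L_eq_zero hρ (by simpa using h₂))

/-- A zero `ρ` (`Re ρ > 0`) of `L` is a zero of `Ξ`. [cite: ThornerZaman2017, §7.2] -/
theorem xiPair_eq_zero_of_L_eq_zero {ρ : ℂ} (hρ : 0 < ρ.re) (h : T.L ρ = 0) : T.xiPair ρ = 0 := by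
  rw [xiPair, T.xi_eq_zero_of_L_eq_zero hρ h, zero_mul]

/-! ### The logarithmic derivative on `Re s > 1` -/

/-- The conductor factor: `logDeriv (A^{·/2}) = (log A)/2`. [cite: ThornerZaman2017, Lemma 2.1] -/
theorem logDeriv_cond_cpow (h𝔣 : 𝔣 ≠ ⊥) (s : ℂ) :
    logDeriv (fun z : ℂ ↦ ((rayCond K 𝔣 : ℝ) : ℂ) ^ (z / 2)) s = (Real.log (rayCond K 𝔣) : ℂ) / 2 := by
  have hA1 := one_le_rayCond (K := K) h𝔣
  have hA : ((rayCond K 𝔣 : ℝ) : ℂ) ≠ 0 := Complex.ofReal_ne_zero.mpr (by linarith)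
  have hd : HasDerivAt (fun z : ℂ ↦ ((rayCond K 𝔣 : ℝ) : ℂ) ^ (z / 2))
      (((rayCond K 𝔣 : ℝ) : ℂ) ^ (s / 2) * Complex.log ((rayCond K 𝔣 : ℝ) : ℂ) * (1 / 2)) s := by
    have h1 : HasDerivAt (fun z : ℂ ↦ z / 2) (1 / 2 : ℂ) s := (hasDerivAt_id s).div_const 2
    exact h1.const_cpow (Or.inl hA)
  have hne : ((rayCond K 𝔣 : ℝ) : ℂ) ^ (s / 2) ≠ 0 := by
    rw [Ne, cpow_eq_zero_iff, not_and_or]; exact Or.inl hA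
  rw [logDeriv_apply, hd.deriv, ← Complex.ofReal_log (by linarith)]
  field_simp

/-- On `Re s > 1`:
`Ξ'/Ξ(s) = 2/s + 2/(s − 1) + log A + 2 L_∞'/L_∞(s) + L'/L(s) + L''/L'(s)`. [cite: ThornerZaman2017, Lemma 2.1] -/
theorem logDeriv_xiPair {s : ℂ} (hs : 1 < s.re) :
    logDeriv T.xiPair s = 2 / s + 2 / (s - 1) + (Real.log (rayCond K 𝔣) : ℂ) +
      2 * logDeriv (rayClassGammaFactor K p) s + logDeriv T.L s + logDeriv T.L' s := by
  have hs0 : 0 < s.re := by linarith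
  have hs1 : s ≠ 1 := fun h ↦ by rw [h, one_re] at hs; exact lt_irrefl _ hs
  have hsne0 : s ≠ 0 := fun h ↦ by rw [h, zero_re] at hs; linarith
  have h𝔣 := T.ne_bot
  have hA : ((rayCond K 𝔣 : ℝ) : ℂ) ≠ 0 :=
    Complex.ofReal_ne_zero.mpr (by linarith [one_le_rayCond (K := K) h𝔣])
  have hU : ∀ᶠ z : ℂ in 𝓝 s, 0 < z.re := (isOpen_lt continuous_const continuous_re).mem_nhds hs0
  set Ac : ℂ → ℂ := fun z ↦ ((rayCond K 𝔣 : ℝ) : ℂ) ^ (z / 2) with hAc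
  -- near `s`: `ξ_M(z) = (z(z−1)) · ((A^{z/2} γ(z)) M(z))`
  have hev : ∀ U : RayXiData K 𝔣 p, U.xi =ᶠ[𝓝 s]
      fun z ↦ (z * (z - 1)) * ((Ac z * rayClassGammaFactor K p z) * U.L z) := by
    intro U
    filter_upwards [hU] with z hz
    rw [U.xi_eq_of_re_pos hz, rayXiG]
  have hγd : DifferentiableAt ℂ (rayClassGammaFactor K p) s := differentiableAt_rayClassGammaFactor_of_re_pos p hs0
  have hγ0 : rayClassGammaFactor K p s ≠ 0 := rayClassGammaFactor_ne_zero p hs0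
  have hAd : DifferentiableAt ℂ Ac s := (differentiableAt_id.div_const 2).const_cpow (Or.inl hA)
  have hA0 : Ac s ≠ 0 := by rw [hAc]; simp only []; rw [Ne, cpow_eq_zero_iff, not_and_or]; exact Or.inl hA
  have hpoly : logDeriv (fun z : ℂ ↦ z * (z - 1)) s = 1 / s + 1 / (s - 1) := by
    rw [logDeriv_mul (f := fun z : ℂ ↦ z) (g := fun z : ℂ ↦ z - 1) s hsne0 (sub_ne_zero.mpr hs1)
      differentiableAt_id (differentiableAt_id.sub_const 1)]
    rw [show (fun z : ℂ ↦ z) = id from rfl, logDeriv_id]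
    have : logDeriv (fun z : ℂ ↦ z - 1) s = 1 / (s - 1) := by
      rw [logDeriv_apply, deriv_sub_const, deriv_id'']
    rw [this]
  have hAγ : logDeriv (fun z ↦ Ac z * rayClassGammaFactor K p z) s =
      (Real.log (rayCond K 𝔣) : ℂ) / 2 + logDeriv (rayClassGammaFactor K p) s := by
    rw [logDeriv_mul (f := Ac) (g := rayClassGammaFactor K p) s hA0 hγ0 hAd hγd, hAc, logDeriv_cond_cpow h𝔣]
  have hU' : ∀ U : RayXiData K 𝔣 p, logDeriv U.xi s =
      1 / s + 1 / (s - 1) + ((Real.log (rayCond K 𝔣) : ℂ) / 2 + logDeriv (rayClassGammaFactor K p) s) +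
        logDeriv U.L s := by
    intro U
    have hL0 : U.L s ≠ 0 := U.L_ne_zero s hs
    have hLd : DifferentiableAt ℂ U.L s := U.differentiable_L s
    rw [logDeriv_congr_of_eventuallyEq (hev U),
      logDeriv_mul (f := fun z : ℂ ↦ z * (z - 1)) (g := fun z ↦ (Ac z * rayClassGammaFactor K p z) * U.L z) s
        (mul_ne_zero hsne0 (sub_ne_zero.mpr hs1)) (mul_ne_zero (mul_ne_zero hA0 hγ0) hL0)
        (differentiableAt_id.mul (differentiableAt_id.sub_const 1)) ((hAd.mul hγd).mul hLd),
      hpoly, logDeriv_mul (f := fun z ↦ Ac z * rayClassGammaFactor K p z) (g := U.L) s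
        (mul_ne_zero hA0 hγ0) hL0 (hAd.mul hγd) hLd, hAγ]
    ring
  have hpair : T.xiPair = fun z ↦ T.xi z * T.swap.xi z := rfl
  rw [hpair, logDeriv_mul (f := T.xi) (g := T.swap.xi) s (T.xi_ne_zero_of_one_lt_re hs)
    (T.swap.xi_ne_zero_of_one_lt_re hs) (T.differentiable_xi s) (T.swap.differentiable_xi s), hU' T, hU' T.swap,
    swap_L]
  ring

end RayXiData

end Literature.NumberTheory.LFunctions

end
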